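import Mathlib.LinearAlgebra.Matrix.PosDef
import Mathlib.Analysis.RCLike.Basic
import Mathlib.Tactic.NoncommRing
import HarnessLib

/-!
# Trace monotonicity of the cube on the positive cone: `0 ≤ A ≤ B ⇒ tr A³ ≤ tr B³` — the finite shadow of the W4 card's trace step (S-W4-3)

builds on p205010 (kernel theorem, internal audit signed; external expert review pending) — nothing in this file uses p205010; elementary linear
algebra over Mathlib's `Matrix.PosSemidef`.  Lane `prim-bschramm`, seat `prim-bschramm-stmt` gen 41 (port pen) under lead g28's W4 S-item order of
record (#9179 / #9232, item (1) «the trace-monotonicity finite shadow», director-frontier g15 #9163 (3)); design desk p3 g41's caution #9178 («Loewner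
order does NOT give `B³ ≥ A³`; eigenvalue domination is the honest lemma») is MET WITHOUT EIGENVALUES for the cube: Courant–Fischer / Weyl monotonicity
is not in Mathlib, but the TRACE of the cube is monotone by an elementary identity.  Proof-only helper file (`--supports stmt-CriticalPhenomena-4575 --as
helper`): NO definition, no `@[conjecture]`, nothing about `θ(p_c)`; it is the finite-dimensional shadow of the trace-comparison step in the W4 card
«nc-h-diagram-gk-wheel-kss» (w-idea-1 g6 CARD-5 b469e7af, road B: the wheel as a trace on `ℓ²(Γ)` priced by Schatten–Hölder), recorded in VERDICTS :511 with
the refuter's precision «`tr A³ ≤ tr B³` via eigenvalue domination, not operator monotonicity» (p5-g34 #9161) — here by a third route.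

THE IDENTITY.  For Hermitian `A` and `D` (here `D := B − A`):
`(A + D)³ = A³ + (A·D·A + A·A·D + D·A·A) + (D·A·D + A·D·D + D·D·A) + D·D·D` (a non-commutative expansion, `noncomm_ring`), and by the cyclicity of the
trace each bracket has trace `3·tr(A D A)` resp. `3·tr(D A D)`; now `A D A = Aᴴ D A`, `D A D = Dᴴ A D`, `D D D = Dᴴ D D` are CONGRUENCES of positive
semidefinite matrices, hence positive semidefinite (Mathlib `Matrix.PosSemidef.conjTranspose_mul_mul_same`) with nonnegative trace
(`Matrix.PosSemidef.trace_nonneg`).  So `tr B³ − tr A³ = 3 tr(ADA) + 3 tr(DAD) + tr(D³) ≥ 0`.  HONEST SCOPE: the cube only.  The general statement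
«`tr f(A) ≤ tr f(B)` for every monotone `f` and `0 ≤ A ≤ B`» DOES need eigenvalue domination (Courant–Fischer min–max), which Mathlib lacks —
`-- TODO(general form)`; the square `tr A² ≤ tr B²` would need `√A` (`Matrix.PosSemidef.sqrt`), not typed here either.

* `trace_conjTranspose_mul_mul_nonneg` — `0 ≤ tr(Xᴴ P X)` for `P` PSD;
* `trace_three_cycle` — `tr(A A D) = tr(A D A)` and `tr(D A A) = tr(A D A)`;
* **`trace_pow_three_mono (hA : A.PosSemidef) (hBA : (B − A).PosSemidef) : (A ^ 3).trace ≤ (B ^ 3).trace`** (any `RCLike 𝕜`, order = `ComplexOrder`);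
* `trace_pow_three_mono_real` — the same for real symmetric matrices, in `ℝ`'s order.
[cite: HornJohnson2013, Cor. 7.7.4 (Loewner order ⇒ ordered eigenvalues, trace)]
-/

namespace Summit.CriticalPhenomena.PercolationContinuityZ3.Theorems.Transplant

namespace TraceShadow

open Matrix
open scoped ComplexOrder

variable {𝕜 : Type*} [RCLike 𝕜] {n : Type*} [Fintype n] [DecidableEq n]

omit [DecidableEq n] in
/-- **The trace of a congruence of a PSD matrix is nonnegative**: `0 ≤ tr(Xᴴ P X)`. [cite: HornJohnson2013, Obs. 7.1.8(a) (congruence preserves PSD; used in Thm. 7.7.2(a))] -/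
theorem trace_conjTranspose_mul_mul_nonneg {P : Matrix n n 𝕜} (hP : P.PosSemidef) (X : Matrix n n 𝕜) : 0 ≤ (Xᴴ * P * X).trace :=
  (hP.conjTranspose_mul_mul_same X).trace_nonneg

omit [DecidableEq n] in
/-- **Trace cyclicity for the two mixed cubic words**: `tr(A A D) = tr(A D A)` and `tr(D A A) = tr(A D A)`. [folklore] -/
theorem trace_three_cycle (A D : Matrix n n 𝕜) : (A * A * D).trace = (A * D * A).trace ∧ (D * A * A).trace = (A * D * A).trace := by
  constructor
  · rw [Matrix.trace_mul_comm (A * D) A, Matrix.mul_assoc]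
  · rw [Matrix.trace_mul_comm (D * A) A, Matrix.mul_assoc]

/-- **`0 ≤ A ≤ B ⇒ tr A³ ≤ tr B³`** for Hermitian positive semidefinite matrices over `ℝ` or `ℂ` (any `RCLike 𝕜`, in the order `ComplexOrder`): with
`D := B − A ≥ 0`, `tr B³ − tr A³ = 3·tr(A D A) + 3·tr(D A D) + tr(D D D)` and each term is the trace of a congruence of a PSD matrix.  No eigenvalues,
no operator monotonicity (which fails for the cube). [cite: HornJohnson2013, Cor. 7.7.4 (Loewner order ⇒ ordered eigenvalues, trace)] -/
theorem trace_pow_three_mono {A B : Matrix n n 𝕜} (hA : A.PosSemidef) (hBA : (B - A).PosSemidef) : (A ^ 3).trace ≤ (B ^ 3).trace := by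
  set D : Matrix n n 𝕜 := B - A with hD
  have hB : B = A + D := by rw [hD]; abel
  have hAh : Aᴴ = A := hA.1
  have hDh : Dᴴ = D := hBA.1
  -- the three nonnegative traces
  have h1 : 0 ≤ (A * D * A).trace := by simpa only [hAh] using trace_conjTranspose_mul_mul_nonneg hBA A
  have h2 : 0 ≤ (D * A * D).trace := by simpa only [hDh] using trace_conjTranspose_mul_mul_nonneg hA D
  have h3 : 0 ≤ (D * D * D).trace := by simpa only [hDh] using trace_conjTranspose_mul_mul_nonneg hBA D
  -- the non-commutative expansion of the cube
  have hexp : (A + D) ^ 3 = A ^ 3 + (A * D * A + A * A * D + D * A * A) + (D * A * D + A * D * D + D * D * A) + D * D * D := by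
    noncomm_ring
  obtain ⟨c1, c2⟩ := trace_three_cycle A D
  -- `tr(D D A) = tr(D A D)` and `tr(A D D) = tr(D A D)`: the same lemma with the roles of `A`, `D` exchanged
  obtain ⟨c3, c4⟩ := trace_three_cycle D A
  have key : (B ^ 3).trace = (A ^ 3).trace + (((A * D * A).trace + (A * D * A).trace + (A * D * A).trace) +
      ((D * A * D).trace + (D * A * D).trace + (D * A * D).trace) + (D * D * D).trace) := by
    rw [hB, hexp, Matrix.trace_add, Matrix.trace_add, Matrix.trace_add, Matrix.trace_add, Matrix.trace_add, Matrix.trace_add, Matrix.trace_add,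
      c1, c2, c3, c4]
    ring
  rw [key]
  exact le_add_of_nonneg_right (add_nonneg (add_nonneg (add_nonneg (add_nonneg h1 h1) h1) (add_nonneg (add_nonneg h2 h2) h2)) h3)

/-- **Real symmetric version**: `0 ≤ A ≤ B` (PSD, in the Loewner order) ⇒ `tr A³ ≤ tr B³` in `ℝ`. [cite: HornJohnson2013, Cor. 7.7.4 (Loewner order ⇒ ordered eigenvalues, trace)] -/
theorem trace_pow_three_mono_real {A B : Matrix n n ℝ} (hA : A.PosSemidef) (hBA : (B - A).PosSemidef) : (A ^ 3).trace ≤ (B ^ 3).trace :=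
  trace_pow_three_mono hA hBA

end TraceShadow

end Summit.CriticalPhenomena.PercolationContinuityZ3.Theorems.Transplant
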